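import Summits.FinalStateConjecture.FinalStateConjecture.Theorems.ZeroEnergyKerrOrBombSymplecticDualOfTheBombSig4
import HarnessLib

/-!
# Route ZeroEnergyKerrOrBomb · crux `FinalStateFromKerrOrBomb` (stmt-FinalStateConjecture-17839), line `SketchIdeator1` —
# wave 6, W17 boost audit: the LORENTZ TIME SANDWICH (brick B1 of the boost-general junction plan)

Helper file (`--supports stmt-FinalStateConjecture-17839`; registered helpers `lorentz_time_sandwich`,
`poincareInv_time_sandwich`, `one_le_lorentz_basisVector_zero`) of the lead's wave-6 auditor W17 (2026-08-17); see
`work/stubs/W17-boost-audit.md` §5.3, §7.2, §9.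

For a Lorentz transformation `Λ` put `γ := (Λ e₀)⁰` and `u := √(γ² − 1)`. Then `(Λ⁻¹ e₀)⁰ = γ`,
`‖(Λ⁻¹ e₀)_{space}‖ = u`, and for every `w : E4`
  `|(Λ w)⁰ − γ w⁰| ≤ u ‖w_{space}‖`                                   (`lorentz_time_sandwich`),
because `(Λ w)⁰ = −η(e₀, Λ w) = −η(Λ⁻¹ e₀, w) = γ w⁰ − ⟪(Λ⁻¹e₀)_{sp}, w_{sp}⟫` and Cauchy–Schwarz. Read for the motion
`(Λ, c)` of a hole: the LAB time of the event with REST coordinates `w` lies in `γ w⁰ + c⁰ ± u ‖w_{sp}‖`, and the rest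
time of the lab coordinate `x` satisfies `|x⁰ − c⁰ − γ t(x)| ≤ u ‖(Λ⁻¹(x − c))_{sp}‖` (`poincareInv_time_sandwich`) — the
quantitative link between the rest-time Kerr–Schild slabs and the lab-time flat slabs of the settling currencies (lab-lateness
of certified slabs of radius `R(t)`: `γ(t − (u/γ)R(t)) + c⁰`; rest time `≤ (lab time − c⁰ + u·radius)/γ`), replacing the
isochrony `Λ e₀ = e₀` used by the wave-5 junction bricks. For orthochronous `Λ`, `γ ≥ 1`
(`one_le_lorentz_basisVector_zero`). Elementary special relativity; nothing restated.
References: O'Neill 1983, Ch. 9, pp. 233–236 (the Lorentz group); Jackson, Classical Electrodynamics, (11.19).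
-/

set_option linter.dupNamespace false
set_option maxSynthPendingDepth 3

noncomputable section

open scoped Manifold ContDiff Topology RealInnerProductSpace
open Set Filter Function

namespace Summit.FinalStateConjecture.FinalStateConjecture.Theorems.SymplecticDualOfTheBomb

open Literature.Geometry.Lorentzian Summit.FinalStateConjecture.FinalStateConjecture.Theorems.OneLockedExplosion

section Lorentz

variable (Λ : lorentzGroup)

/-- `η(v, w) = −v⁰ w⁰ + ⟪v_{space}, w_{space}⟫`. O'Neill 1983, Ch. 3, p. 55. [folklore] -/
private theorem minkowski_eq_inner_w17 (v w : E4) :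
    Minkowski.bilin v w = -(v 0 * w 0) + ⟪E4.spatial v, E4.spatial w⟫ := by
  -- private copy of `minkowski_eq_inner_w5` (…RecutCoreCOIsochronous, unbuilt today)
  rw [Minkowski.bilin_apply, real_inner_comm, PiLp.inner_apply]
  simp [Fin.sum_univ_three, E4.spatial_apply]

/-- The time axis has no spatial part: `(e₀)_{space} = 0`. [folklore] -/
private theorem spatial_basisVector_zero_w17 : E4.spatial (E4.basisVector 0) = 0 := by
  ext i
  simp [E4.spatial_apply, E4.basisVector, Fin.succ_ne_zero]

/-- `(e₀)⁰ = 1`. [folklore] -/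
private theorem basisVector_zero_apply_zero_w17 : (E4.basisVector 0 : E4) 0 = 1 := by
  simp [E4.basisVector]

/-- **Lab time through the pulled-back time axis**: `(Λ w)⁰ = ũ⁰ w⁰ − ⟪ũ_{space}, w_{space}⟫` with `ũ := Λ⁻¹ e₀`
(`(Λ w)⁰ = −η(e₀, Λ w) = −η(Λ⁻¹ e₀, w)`). O'Neill 1983, Ch. 9, p. 233. [folklore] -/
private theorem lorentz_apply_zero_eq_w17 (w : E4) :
    (Λ : E4 ≃L[ℝ] E4) w 0 = (Λ : E4 ≃L[ℝ] E4).symm (E4.basisVector 0) 0 * w 0 -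
      ⟪E4.spatial ((Λ : E4 ≃L[ℝ] E4).symm (E4.basisVector 0)), E4.spatial w⟫ := by
  -- private copy of `lorentz_apply_zero_eq` (…RecutCoreCOIsochronous, unbuilt today)
  have h := Λ.2 ((Λ : E4 ≃L[ℝ] E4).symm (E4.basisVector 0)) w
  rw [ContinuousLinearEquiv.apply_symm_apply, Minkowski.bilin_basisVector_zero_left, minkowski_eq_inner_w17] at h
  linarith

/-- **The Lorentz factor read on either side**: `(Λ⁻¹ e₀)⁰ = (Λ e₀)⁰` (`= −η(Λ⁻¹e₀, e₀) = −η(e₀, Λ e₀)`).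
O'Neill 1983, Ch. 9, p. 233. [folklore] -/
theorem lorentz_symm_basisVector_apply_zero :
    (Λ : E4 ≃L[ℝ] E4).symm (E4.basisVector 0) 0 = (Λ : E4 ≃L[ℝ] E4) (E4.basisVector 0) 0 := by
  have h := lorentz_apply_zero_eq_w17 Λ (E4.basisVector 0)
  rw [spatial_basisVector_zero_w17, inner_zero_right, sub_zero, basisVector_zero_apply_zero_w17, mul_one] at h
  exact h.symm

/-- **The pulled-back time axis is a unit timelike vector**: `‖(Λ⁻¹ e₀)_{space}‖² = ((Λ e₀)⁰)² − 1`
(`η(Λ⁻¹e₀, Λ⁻¹e₀) = η(e₀, e₀) = −1`). O'Neill 1983, Ch. 9, p. 233. [folklore] -/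
theorem lorentz_symm_basisVector_spatialNorm_sq :
    E4.spatialNorm ((Λ : E4 ≃L[ℝ] E4).symm (E4.basisVector 0)) ^ 2 =
      ((Λ : E4 ≃L[ℝ] E4) (E4.basisVector 0) 0) ^ 2 - 1 := by
  have h := Λ.2 ((Λ : E4 ≃L[ℝ] E4).symm (E4.basisVector 0)) ((Λ : E4 ≃L[ℝ] E4).symm (E4.basisVector 0))
  rw [ContinuousLinearEquiv.apply_symm_apply, Minkowski.bilin_basisVector_zero, minkowski_eq_inner_w17,
    real_inner_self_eq_norm_sq, lorentz_symm_basisVector_apply_zero] at h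
  rw [E4.spatialNorm]
  linarith

/-- `‖(Λ⁻¹ e₀)_{space}‖ = √(((Λ e₀)⁰)² − 1)`. O'Neill 1983, Ch. 9, p. 233. [folklore] -/
theorem lorentz_symm_basisVector_spatialNorm :
    E4.spatialNorm ((Λ : E4 ≃L[ℝ] E4).symm (E4.basisVector 0)) =
      √(((Λ : E4 ≃L[ℝ] E4) (E4.basisVector 0) 0) ^ 2 - 1) := by
  rw [← lorentz_symm_basisVector_spatialNorm_sq, Real.sqrt_sq (E4.spatialNorm_nonneg _)]

/-- **Lorentz time sandwich** (registered helper, W17 brick B1): for every Lorentz transformation `Λ` and every `w : E4`,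
`|(Λ w)⁰ − γ w⁰| ≤ √(γ² − 1) ‖w_{space}‖` with `γ = (Λ e₀)⁰` — the lab time of a rest-frame coordinate is its rest time
dilated by `γ`, up to the light-travel term across its rest-frame distance from the axis. O'Neill 1983, Ch. 9, pp. 233–236;
Jackson (11.19). [folklore] -/
theorem lorentz_time_sandwich : ∀ (Λ : lorentzGroup) (w : E4), |(Λ : E4 ≃L[ℝ] E4) w 0 - (Λ : E4 ≃L[ℝ] E4) (E4.basisVector 0) 0 * w 0| ≤ √(((Λ : E4 ≃L[ℝ] E4) (E4.basisVector 0) 0) ^ 2 - 1) * E4.spatialNorm w := by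
  intro Λ w
  rw [lorentz_apply_zero_eq_w17, lorentz_symm_basisVector_apply_zero, ← lorentz_symm_basisVector_spatialNorm Λ]
  have h := abs_real_inner_le_norm (E4.spatial ((Λ : E4 ≃L[ℝ] E4).symm (E4.basisVector 0))) (E4.spatial w)
  rw [show (Λ : E4 ≃L[ℝ] E4) (E4.basisVector 0) 0 * w 0 -
      ⟪E4.spatial ((Λ : E4 ≃L[ℝ] E4).symm (E4.basisVector 0)), E4.spatial w⟫ -
        (Λ : E4 ≃L[ℝ] E4) (E4.basisVector 0) 0 * w 0 =
      -⟪E4.spatial ((Λ : E4 ≃L[ℝ] E4).symm (E4.basisVector 0)), E4.spatial w⟫ by ring, abs_neg]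
  simpa [E4.spatialNorm] using h

/-- **Rest time from lab time** (registered helper, W17 brick B1, `poincareInv` form): for the motion `(Λ, c)` and a lab
coordinate `x`, the rest-frame time `t(x) = (Λ⁻¹(x − c))⁰` satisfies `|x⁰ − c⁰ − γ t(x)| ≤ √(γ² − 1) ‖(Λ⁻¹(x − c))_{space}‖`,
`γ = (Λ e₀)⁰`. For the boosted backgrounds of the settling currencies (`time x = t(x)`, `radius x ≈ ‖(Λ⁻¹(x−c))_{sp}‖`)
this bounds the rest time of a certified coordinate by its lab time and its certified radius. O'Neill 1983, Ch. 9, p. 236.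
[folklore] -/
theorem poincareInv_time_sandwich : ∀ (Λ : lorentzGroup) (c x : E4), |x 0 - c 0 - (Λ : E4 ≃L[ℝ] E4) (E4.basisVector 0) 0 * poincareInv Λ c x 0| ≤ √(((Λ : E4 ≃L[ℝ] E4) (E4.basisVector 0) 0) ^ 2 - 1) * E4.spatialNorm (poincareInv Λ c x) := by
  intro Λ c x
  have h := lorentz_time_sandwich Λ (poincareInv Λ c x)
  have hx : (Λ : E4 ≃L[ℝ] E4) (poincareInv Λ c x) = x - c := by
    rw [poincareInv, ContinuousLinearEquiv.apply_symm_apply]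
  rw [hx, PiLp.sub_apply] at h
  exact h

/-- **Orthochronous Lorentz factors are at least one** (registered helper, W17 brick B1): if `(Λ e₀)⁰ > 0` then
`(Λ e₀)⁰ ≥ 1`, since `((Λ e₀)⁰)² = 1 + ‖(Λ⁻¹e₀)_{space}‖²`. O'Neill 1983, Ch. 9, p. 233. [folklore] -/
theorem one_le_lorentz_basisVector_zero : ∀ (Λ : lorentzGroup), IsOrthochronous Λ → 1 ≤ (Λ : E4 ≃L[ℝ] E4) (E4.basisVector 0) 0 := by
  intro Λ hΛ
  have h := lorentz_symm_basisVector_spatialNorm_sq Λ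
  have h0 : 0 < (Λ : E4 ≃L[ℝ] E4) (E4.basisVector 0) 0 := hΛ
  nlinarith [sq_nonneg (E4.spatialNorm ((Λ : E4 ≃L[ℝ] E4).symm (E4.basisVector 0))), h, h0]

/-- **Lab time of a moved rest coordinate, lower bound** (the lab-lateness estimate of certified rest slabs): for the motion
`(Λ, c)`, `(Λ w + c)⁰ ≥ γ w⁰ − √(γ² − 1) ‖w_{space}‖ + c⁰`. In particular a truncated rest slab `{w⁰ = σ, ‖w_{sp}‖ ≤ ϱ}`
is moved into `{x⁰ ≥ γ(σ − ϱ) + c⁰}` (`√(γ² − 1) ≤ γ`). O'Neill 1983, Ch. 9, p. 236. [folklore] -/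
theorem lab_time_ge_of_rest (c w : E4) :
    (Λ : E4 ≃L[ℝ] E4) (E4.basisVector 0) 0 * w 0 - √(((Λ : E4 ≃L[ℝ] E4) (E4.basisVector 0) 0) ^ 2 - 1) * E4.spatialNorm w
        + c 0 ≤ ((Λ : E4 ≃L[ℝ] E4) w + c) 0 := by
  have h := lorentz_time_sandwich Λ w
  rw [PiLp.add_apply]
  linarith [(abs_le.mp h).1]

/-- **Lab time of a moved rest coordinate, upper bound**: `(Λ w + c)⁰ ≤ γ w⁰ + √(γ² − 1) ‖w_{space}‖ + c⁰`.
O'Neill 1983, Ch. 9, p. 236. [folklore] -/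
theorem lab_time_le_of_rest (c w : E4) :
    ((Λ : E4 ≃L[ℝ] E4) w + c) 0 ≤ (Λ : E4 ≃L[ℝ] E4) (E4.basisVector 0) 0 * w 0 +
      √(((Λ : E4 ≃L[ℝ] E4) (E4.basisVector 0) 0) ^ 2 - 1) * E4.spatialNorm w + c 0 := by
  have h := lorentz_time_sandwich Λ w
  rw [PiLp.add_apply]
  linarith [(abs_le.mp h).2]

end Lorentz

end Summit.FinalStateConjecture.FinalStateConjecture.Theorems.SymplecticDualOfTheBomb

end
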